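import Summits.BirchSwinnertonDyer.BirchSwinnertonDyer.Theorems.TwoAdicConverseTwoDivisionCubicSplitsAtTwo
import Mathlib.Algebra.QuadraticDiscriminant
import HarnessLib

/-!
# Route `TwoAdicConverse` (rung S3), crux `OrdLambdaHalfAtTwo` (item 19556): the DYADIC TYPE of the `2`-division field at an
# ordinary `2` — `#{roots of ψ₂² in ℚ₂} = 3` if `Δ` is a `2`-adic square, `= 1` otherwise (never `0`)

Cell `bsd-2adic`, seat `bsd-2adic-conv-1` (GEN 21). THEOREMS ONLY — no named fact, no definition, nothing conditional. Sequel of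
`TwoAdicConverseTwoDivisionCubicSplitsAtTwo` (Hensel root `x₀` of `ψ₂² = 4x³ + b₂x² + 2b₄x + b₆` at `a₁` odd; splitting when
`Δ ∈ ℚ₂×²`). Here the complementary half: when `Δ` is NOT a `2`-adic square the quadratic cofactor
`4x² + (4x₀ + b₂)x + (4x₀² + b₂x₀ + 2b₄)` has discriminant `16Δ/ψ₂²′(x₀)²`, a non-square, hence no `ℚ₂`-root: `ψ₂²` has EXACTLY
ONE root in `ℚ₂`. So at a good-ordinary or multiplicative `2` the prime `2` is never inert in the cubic field of a `2`-torsion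
point, and its decomposition type — the pen's dyadic keying datum `w₂` for the 19556 lines (RC-246 (B): «split-class / transfer
stubs are keyed by the dyadic place datum») and the defining condition `Δ ∉ (ℚ₂ˣ)²` of reserve #1 `elliptic-shadow-two`'s rigid
locus `𝔖⁻` — is READ OFF the `2`-adic square class of `Δ`:

* `card_roots_twoTorsionPolynomial_padic_two_eq_one` — `a₁` odd, `Δ ∉ ℚ₂×²` ⇒ `roots.card = 1`;
* `card_roots_twoTorsionPolynomial_padic_two_eq_three_iff` — `a₁` odd ⇒ (`roots.card = 3 ⟺ Δ ∈ ℚ₂×²`);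
* `card_roots_twoTorsionPolynomial_padic_two_eq_one_or_three` — the dichotomy (cards `0`, `2` do not occur);
* leaf-currency corollaries under `GoodOrd W 2 ∨ Mult W 2`.

HONEST FRAMING: local algebra only; nothing about `λ`, Selmer groups or BSD; items 19556 / 19218 stay OPEN; BSD is not proved by any of
this. PARTITION (D-0054): none — RANK axis (S3). References: J. H. Silverman, *AEC* (2009), VII.2–VII.3; Mathlib `hensels_lemma`,
`quadratic_ne_zero_of_discrim_ne_sq`. [SilvermanAEC2009]
-/

set_option linter.dupNamespace false
set_option autoImplicit false

noncomputable section

open scoped Classical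
open Polynomial WeierstrassCurve Literature.NumberTheory.EllipticCurves Literature.NumberTheory.EllipticCurves.Greenberg1999
  Literature.NumberTheory.EllipticCurves.Rank1Residual

namespace Summit.BirchSwinnertonDyer.BirchSwinnertonDyer.Theorems.TwoAdicTwistConverse

variable (W : WeierstrassCurve ℚ) [W.IsElliptic] [W.IsGloballyMinimal]

omit [W.IsElliptic] [W.IsGloballyMinimal] in
/-- **The factorisation `ψ₂² = (x − r)·(4x² + (4r + b₂)x + (4r² + b₂r + 2b₄))` at a root `r`**, as an identity of polynomials
over any field of characteristic `0` (the constant terms agree by `ψ₂²(r) = 0`). [folklore] -/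
theorem map_twoTorsionPolynomial_eq_mul_of_root {K : Type*} [Field K] [CharZero K] {r : K}
    (hr : 4 * r ^ 3 + (W.b₂ : K) * r ^ 2 + 2 * (W.b₄ : K) * r + (W.b₆ : K) = 0) :
    (W.twoTorsionPolynomial.toPoly).map (algebraMap ℚ K) =
      (X - C r) * (C 4 * X ^ 2 + C (4 * r + (W.b₂ : K)) * X + C (4 * r ^ 2 + (W.b₂ : K) * r + 2 * (W.b₄ : K))) := by
  have hs : (W.b₆ : K) = -(4 * r ^ 3 + (W.b₂ : K) * r ^ 2 + 2 * (W.b₄ : K) * r) := by linear_combination hr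
  rw [← Cubic.map_toPoly]
  simp only [Cubic.map, Cubic.toPoly, WeierstrassCurve.twoTorsionPolynomial, eq_ratCast, hs, map_neg, map_add, map_mul,
    map_pow, map_ofNat]
  ring

omit [W.IsElliptic] in
/-- **`Δ ∉ ℚ₂×²` ⇒ the `2`-division cubic has EXACTLY ONE root in `ℚ₂`** (for `a₁` odd): the Hensel root `x₀`, the quadratic
cofactor having the non-square discriminant `16Δ/ψ₂²′(x₀)²`. [folklore] -/
theorem card_roots_twoTorsionPolynomial_padic_two_eq_one (ha₁ : Odd (integralModelInt W).a₁)
    (hΔ : ¬ IsSquare ((W.Δ : ℚ) : ℚ_[2])) :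
    Multiset.card ((W.twoTorsionPolynomial.toPoly).map (algebraMap ℚ ℚ_[2])).roots = 1 := by
  haveI : Fact (Nat.Prime 2) := ⟨Nat.prime_two⟩
  obtain ⟨r, hr, -⟩ := exists_padic_root_twoDivisionCubic_of_odd_a₁ W ha₁
  set p : ℚ_[2] := (W.b₂ : ℚ_[2]) with hp
  set q : ℚ_[2] := (W.b₄ : ℚ_[2]) with hq
  have hkey : ((4 * r + p) ^ 2 - 16 * (4 * r ^ 2 + p * r + 2 * q)) * (12 * r ^ 2 + 2 * p * r + 2 * q) ^ 2 =
      16 * ((W.Δ : ℚ) : ℚ_[2]) :=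
    sixteen_mul_Δ_eq_of_root W hr
  -- the quadratic cofactor has no root in `ℚ₂`
  set g : ℚ_[2][X] := C 4 * X ^ 2 + C (4 * r + p) * X + C (4 * r ^ 2 + p * r + 2 * q) with hg
  have hdisc : ∀ t : ℚ_[2], discrim 4 (4 * r + p) (4 * r ^ 2 + p * r + 2 * q) ≠ t ^ 2 := by
    intro t ht
    apply hΔ
    refine ⟨t * (12 * r ^ 2 + 2 * p * r + 2 * q) / 4, ?_⟩
    rw [discrim] at ht
    linear_combination (-1 / 16 : ℚ_[2]) * hkey + ((12 * r ^ 2 + 2 * p * r + 2 * q) ^ 2 / 16) * ht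
  have hgeval : ∀ t : ℚ_[2], g.eval t = 4 * (t * t) + (4 * r + p) * t + (4 * r ^ 2 + p * r + 2 * q) := by
    intro t
    simp only [hg, eval_add, eval_mul, eval_C, eval_pow, eval_X]
    ring
  have hg0 : g ≠ 0 := by
    intro h0
    have h := hgeval 0
    rw [h0, eval_zero] at h
    exact quadratic_ne_zero_of_discrim_ne_sq hdisc 0 h.symm
  have hgroots : g.roots = 0 := by
    refine Multiset.eq_zero_of_forall_notMem fun t ht ↦ ?_
    rw [mem_roots hg0, IsRoot.def, hgeval] at ht
    exact quadratic_ne_zero_of_discrim_ne_sq hdisc t ht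
  have hXr : (X - C r) * g ≠ 0 := mul_ne_zero (X_sub_C_ne_zero r) hg0
  rw [map_twoTorsionPolynomial_eq_mul_of_root W hr, ← hg, roots_mul hXr, roots_X_sub_C, hgroots]
  rfl

/-- **The dyadic dichotomy**: for `a₁` odd, `ψ₂²` has `3` roots in `ℚ₂` iff `Δ` is a `2`-adic square (and `1` root otherwise).
[folklore] -/
theorem card_roots_twoTorsionPolynomial_padic_two_eq_three_iff (ha₁ : Odd (integralModelInt W).a₁) :
    Multiset.card ((W.twoTorsionPolynomial.toPoly).map (algebraMap ℚ ℚ_[2])).roots = 3 ↔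
      IsSquare ((W.Δ : ℚ) : ℚ_[2]) := by
  refine ⟨fun h3 ↦ ?_, card_roots_twoTorsionPolynomial_padic_two W ha₁⟩
  by_contra hΔ
  have h1 := card_roots_twoTorsionPolynomial_padic_two_eq_one W ha₁ hΔ
  omega

/-- **`2` is never inert in the field of a `2`-torsion point at an ordinary `2`**: for `a₁` odd the number of `ℚ₂`-roots of `ψ₂²`
is `1` or `3` (never `0` or `2`). [folklore] -/
theorem card_roots_twoTorsionPolynomial_padic_two_eq_one_or_three (ha₁ : Odd (integralModelInt W).a₁) :
    Multiset.card ((W.twoTorsionPolynomial.toPoly).map (algebraMap ℚ ℚ_[2])).roots = 1 ∨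
      Multiset.card ((W.twoTorsionPolynomial.toPoly).map (algebraMap ℚ ℚ_[2])).roots = 3 := by
  by_cases hΔ : IsSquare ((W.Δ : ℚ) : ℚ_[2])
  · exact Or.inr (card_roots_twoTorsionPolynomial_padic_two W ha₁ hΔ)
  · exact Or.inl (card_roots_twoTorsionPolynomial_padic_two_eq_one W ha₁ hΔ)

/-- **Leaf currency**: for `W` good ordinary or multiplicative at `2` and `Δ_W` NOT a `2`-adic square (e.g. the rigid locus `𝔖⁻`
of reserve `elliptic-shadow-two`), `ψ₂²` has exactly one `ℚ₂`-root: `2 = 𝔭₁𝔭₂` (`f = 1, 2`) in the cubic field of a `2`-torsion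
point. [folklore] -/
theorem card_roots_twoTorsionPolynomial_padic_two_eq_one_of_goodOrd_or_mult (hW : GoodOrd W 2 ∨ Mult W 2)
    (hΔ : ¬ IsSquare ((W.Δ : ℚ) : ℚ_[2])) :
    Multiset.card ((W.twoTorsionPolynomial.toPoly).map (algebraMap ℚ ℚ_[2])).roots = 1 :=
  card_roots_twoTorsionPolynomial_padic_two_eq_one W (odd_a₁_integralModelInt_of_goodOrd_or_mult W hW) hΔ

/-- **Leaf currency, dichotomy**: for `W` good ordinary or multiplicative at `2`, `ψ₂²` has `3` roots in `ℚ₂` iff `Δ_W ∈ ℚ₂×²`,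
else exactly `1`. [folklore] -/
theorem card_roots_twoTorsionPolynomial_padic_two_eq_three_iff_of_goodOrd_or_mult (hW : GoodOrd W 2 ∨ Mult W 2) :
    Multiset.card ((W.twoTorsionPolynomial.toPoly).map (algebraMap ℚ ℚ_[2])).roots = 3 ↔
      IsSquare ((W.Δ : ℚ) : ℚ_[2]) :=
  card_roots_twoTorsionPolynomial_padic_two_eq_three_iff W (odd_a₁_integralModelInt_of_goodOrd_or_mult W hW)

end Summit.BirchSwinnertonDyer.BirchSwinnertonDyer.Theorems.TwoAdicTwistConverse

end
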